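import Mathlib
import HarnessLib

/-!
# Octave induction (pure real analysis) — the abstract core of LINE «OctaveDoubling» on the leaf 19868

Planner seat `ym-idea-11` g19, 2026-08-29.  Ported verbatim from the registered skeleton `Cruxes/HypercubicOSDataFromInfiniteVolume/
Lines/octave_doubling.lean` REV 2.1 §2b (critic idea-crit-9 g7 verdict #98 P3: «sorry-free pure real analysis and worth porting now»); namespace
`…Theorems.InfiniteVolumeContinuum.OctaveInduction` (≠ the line file's, so no FQN clash with the registered skeleton — critic ACK #98b (4)).
Statement: a function `c : ℕ → ℝ` on a finite window `t ≤ L` which (D2-shape) grows by at most a factor `K ≤ 2^M` per UV-ward octave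
unless it is below `(C₀/R⁴)²`, and (D1-shape) obeys `(C₁/R⁴)² (ℓ₁/(Rs))^{M₁}` on the non-doublable octaves, satisfies the tempered
envelope `A/R⁸ · (ℓ/(Rs))^M` on the whole window — strong induction on `L − R`.  No lattice, no measure, no gauge theory enters.

HONEST LABEL: an elementary lemma about real sequences; it proves no stub of wall class, no crux, rung, leaf or summit; the
Yang–Mills mass gap is NOT proved.

Landed under `Theorems/` by the prover seat `ym-line-fcl-p3` g36 (2026-08-30, free hands) at the planner's request (verdict #98 P3,
planners cannot propose under `Theorems/`); content unchanged from the crux workfile.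
-/

set_option autoImplicit false

namespace Summit.QuantumFields.YangMills.Theorems.InfiniteVolumeContinuum.OctaveInduction

/-- **Octave induction (pure real analysis).**  `c : ℕ → ℝ` any function of the separation; D1-type anchor on the
non-doublable scales, D2-type step on the doublable ones; conclusion: the tempered envelope at every admissible scale.
Strong induction on `L − R`. -/
theorem octave_induction {c : ℕ → ℝ} {L M₁ M : ℕ} {s ℓ ℓ₁ ℓ₂ κ K C₀ C₁ A : ℝ}
    (hs : 0 < s) (hℓ : 0 < ℓ) (hℓ1 : ℓ ≤ ℓ₁) (hℓ2 : ℓ ≤ ℓ₂) (hκ : 2 * (κ * ℓ₁) ≤ ℓ)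
    (hK : 1 ≤ K) (hKM : K ≤ 2 ^ M) (hM : M₁ ≤ M)
    (hA1 : C₁ ^ 2 * (ℓ₁ / ℓ) ^ M₁ ≤ A) (hA2 : K * C₀ ^ 2 ≤ A)
    (hD1 : ∀ R t : ℕ, 1 ≤ R → (R : ℝ) * s ≤ ℓ₁ → 4 * R + 8 ≤ L → (κ * ℓ₁ < (R : ℝ) * s ∨ L < 8 * R + 8) →
      2 * R + 2 ≤ t → t ≤ L → c t ≤ (C₁ / (R : ℝ) ^ 4) ^ 2 * (ℓ₁ / ((R : ℝ) * s)) ^ M₁)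
    (hD2 : ∀ (R : ℕ) (B : ℝ), 1 ≤ R → 2 * (R : ℝ) * s ≤ ℓ₂ → 8 * R + 8 ≤ L →
      (∀ t' : ℕ, 4 * R + 2 ≤ t' → t' ≤ L → c t' ≤ B) →
      ∀ t : ℕ, 2 * R + 2 ≤ t → t ≤ L → c t ≤ K * max B ((C₀ / (R : ℝ) ^ 4) ^ 2)) :
    ∀ R t : ℕ, 1 ≤ R → (R : ℝ) * s ≤ ℓ → 4 * R + 8 ≤ L → 2 * R + 2 ≤ t → t ≤ L →
      c t ≤ A / (R : ℝ) ^ 8 * (ℓ / ((R : ℝ) * s)) ^ M := by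
  have hK0 : 0 ≤ K := zero_le_one.trans hK
  have hA0 : 0 ≤ A := le_trans (by positivity) hA2
  -- the claim, by strong induction on `L - R`
  suffices key : ∀ n : ℕ, ∀ R : ℕ, L - R = n → 1 ≤ R → (R : ℝ) * s ≤ ℓ → 4 * R + 8 ≤ L →
      ∀ t : ℕ, 2 * R + 2 ≤ t → t ≤ L → c t ≤ A / (R : ℝ) ^ 8 * (ℓ / ((R : ℝ) * s)) ^ M by
    intro R t hR hRs hL ht htL
    exact key (L - R) R rfl hR hRs hL t ht htL
  intro n
  induction n using Nat.strong_induction_on with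
  | _ n ih =>
    intro R hn hR hRs hL t ht htL
    have hr : (0 : ℝ) < R := by exact_mod_cast hR
    have hrs : 0 < (R : ℝ) * s := mul_pos hr hs
    have hone : 1 ≤ ℓ / ((R : ℝ) * s) := (one_le_div hrs).mpr hRs
    have hpowM : 1 ≤ (ℓ / ((R : ℝ) * s)) ^ M := one_le_pow₀ hone
    have hT0 : 0 ≤ A / (R : ℝ) ^ 8 * (ℓ / ((R : ℝ) * s)) ^ M := by positivity
    by_cases hdbl : 2 * (R : ℝ) * s ≤ ℓ ∧ 8 * R + 8 ≤ L
    · -- doublable: step D2 with `B :=` the envelope at `2R`, supplied by the induction hypothesis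
      obtain ⟨h2Rs, h8⟩ := hdbl
      have hB : ∀ t' : ℕ, 4 * R + 2 ≤ t' → t' ≤ L →
          c t' ≤ A / ((2 * R : ℕ) : ℝ) ^ 8 * (ℓ / (((2 * R : ℕ) : ℝ) * s)) ^ M := by
        intro t' ht' ht'L
        refine ih (L - 2 * R) (by omega) (2 * R) rfl (by omega) ?_ (by omega) t' (by omega) ht'L
        push_cast; linarith
      have hstep := hD2 R _ hR (h2Rs.trans hℓ2) h8 hB t ht htL
      refine hstep.trans ?_
      rw [mul_max_of_nonneg _ _ hK0]
      refine max_le ?_ ?_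
      · -- `K · T(2R) ≤ T(R)` because `K ≤ 2^M ≤ 2^(8+M)`
        have hcast : ((2 * R : ℕ) : ℝ) = 2 * (R : ℝ) := by push_cast; ring
        rw [hcast]
        have h1 : A / (2 * (R : ℝ)) ^ 8 * (ℓ / (2 * (R : ℝ) * s)) ^ M =
            (A / (R : ℝ) ^ 8 * (ℓ / ((R : ℝ) * s)) ^ M) * (K / ((2 : ℝ) ^ 8 * 2 ^ M)) * K⁻¹ := by
          have hK' : K ≠ 0 := ne_of_gt (lt_of_lt_of_le one_pos hK)
          rw [show ℓ / (2 * (R : ℝ) * s) = ℓ / ((R : ℝ) * s) / 2 by ring, div_pow, mul_pow]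
          field_simp
        rw [h1]
        have h2 : K / ((2 : ℝ) ^ 8 * 2 ^ M) ≤ 1 := by
          rw [div_le_one (by positivity)]
          calc K ≤ 2 ^ M := hKM
            _ = 1 * 2 ^ M := by ring
            _ ≤ (2 : ℝ) ^ 8 * 2 ^ M := by gcongr; norm_num
        have hK' : K ≠ 0 := ne_of_gt (lt_of_lt_of_le one_pos hK)
        calc K * (A / (R : ℝ) ^ 8 * (ℓ / ((R : ℝ) * s)) ^ M * (K / ((2 : ℝ) ^ 8 * 2 ^ M)) * K⁻¹)
            = (A / (R : ℝ) ^ 8 * (ℓ / ((R : ℝ) * s)) ^ M) * (K / ((2 : ℝ) ^ 8 * 2 ^ M)) := by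
              field_simp
          _ ≤ (A / (R : ℝ) ^ 8 * (ℓ / ((R : ℝ) * s)) ^ M) * 1 := by gcongr
          _ = A / (R : ℝ) ^ 8 * (ℓ / ((R : ℝ) * s)) ^ M := mul_one _
      · -- `K · (C₀/R⁴)² ≤ A/R⁸ ≤ T(R)`
        have h1 : K * (C₀ / (R : ℝ) ^ 4) ^ 2 = K * C₀ ^ 2 / (R : ℝ) ^ 8 := by
          rw [div_pow, ← pow_mul]; ring
        rw [h1]
        calc K * C₀ ^ 2 / (R : ℝ) ^ 8 ≤ A / (R : ℝ) ^ 8 := by gcongr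
          _ = A / (R : ℝ) ^ 8 * 1 := (mul_one _).symm
          _ ≤ A / (R : ℝ) ^ 8 * (ℓ / ((R : ℝ) * s)) ^ M := by gcongr
    · -- non-doublable: anchor D1
      have hoct : κ * ℓ₁ < (R : ℝ) * s ∨ L < 8 * R + 8 := by
        by_cases h8 : 8 * R + 8 ≤ L
        · left
          have : ℓ < 2 * (R : ℝ) * s := not_le.1 fun h => hdbl ⟨h, h8⟩
          linarith
        · right; omega
      have hanc := hD1 R t hR (hRs.trans hℓ1) hL hoct ht htL
      refine hanc.trans ?_
      have hℓne : ℓ ≠ 0 := ne_of_gt hℓ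
      have h1 : ℓ₁ / ((R : ℝ) * s) = (ℓ₁ / ℓ) * (ℓ / ((R : ℝ) * s)) := by
        field_simp
      have h2 : (ℓ₁ / ((R : ℝ) * s)) ^ M₁ ≤ (ℓ₁ / ℓ) ^ M₁ * (ℓ / ((R : ℝ) * s)) ^ M := by
        rw [h1, mul_pow]
        exact mul_le_mul_of_nonneg_left (pow_le_pow_right₀ hone hM)
          (pow_nonneg (div_nonneg (hℓ.le.trans hℓ1) hℓ.le) _)
      have h3 : (C₁ / (R : ℝ) ^ 4) ^ 2 = C₁ ^ 2 / (R : ℝ) ^ 8 := by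
        rw [div_pow, ← pow_mul]
      rw [h3]
      calc C₁ ^ 2 / (R : ℝ) ^ 8 * (ℓ₁ / ((R : ℝ) * s)) ^ M₁
          ≤ C₁ ^ 2 / (R : ℝ) ^ 8 * ((ℓ₁ / ℓ) ^ M₁ * (ℓ / ((R : ℝ) * s)) ^ M) := by gcongr
        _ = (C₁ ^ 2 * (ℓ₁ / ℓ) ^ M₁) / (R : ℝ) ^ 8 * (ℓ / ((R : ℝ) * s)) ^ M := by ring
        _ ≤ A / (R : ℝ) ^ 8 * (ℓ / ((R : ℝ) * s)) ^ M := by gcongr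


end Summit.QuantumFields.YangMills.Theorems.InfiniteVolumeContinuum.OctaveInduction
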